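import Mathlib
import Summits.ValiantsHypothesis.ValiantsHypothesis.Theses.GirthSidon

/-!
# Route GirthSidon — the kill switch is downstream: `PolySwallowForcesShortRelation` (stmt-6537) follows
from each of `FormalSwallowForcesShortRelation` (stmt-6536) and `SwallowForcesShortRelation` (stmt-6535)

The route description records that the polynomial crux (rank 4, the "kill switch") is the common special case
of the formal crux (rank 3) and the pointwise crux (rank 2); this file kernel-checks both implications, so that a
refutation of `PolySwallowForcesShortRelation` (equivalently of the line's residual stub
`stub_totallyBornTargets` together with the landed halves) refutes ranks 2 and 3 as well.

* `polySwallow_of_formal`: a polynomial swallowing `Γ_i(y) = x^{d_i}`, `y_j ∈ ℂ[x]`, is a formal one along the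
  algebra map `ℂ[x] → ℂ((t))`, `x ↦ t` (`Polynomial.aeval (single 1 1)`), since `aeval` commutes with algebra maps.
* `polySwallow_of_swallow`: a polynomial swallowing makes the monomial curve NON-elusive — every point
  `(a^{d_i})_i` is `Γ(y_1(a), …, y_s(a))` — so the pointwise crux applies.
VP ≠ VNP is not moved. [folklore]
-/

set_option linter.dupNamespace false

namespace Summit.ValiantsHypothesis.ValiantsHypothesis.Theorems

open Polynomial
open Summit.ValiantsHypothesis.ValiantsHypothesis.Theses.GirthSidon
open Literature.Computability.AlgebraicComplexity

namespace PolySwallowGlue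

/-- **Rank 3 ⇒ rank 4.**  `FormalSwallowForcesShortRelation → PolySwallowForcesShortRelation`: push the
polynomial sources into `ℂ((t))` along `x ↦ t`. [folklore] -/
theorem polySwallow_of_formal : FormalSwallowForcesShortRelation → PolySwallowForcesShortRelation := by
  rintro ⟨m₀, h⟩
  refine ⟨m₀, fun m hm d s hs Γ y hΓ hy => ?_⟩
  let φ : ℂ[X] →ₐ[ℂ] LaurentSeries ℂ := Polynomial.aeval (HahnSeries.single (1 : ℤ) (1 : ℂ))
  refine h m hm d s hs Γ (fun j => φ (y j)) hΓ fun i => ?_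
  rw [← MvPolynomial.comp_aeval_apply, hy i, map_pow]
  simp only [φ, Polynomial.aeval_X, HahnSeries.single_pow, one_pow]
  congr 1
  simp

/-- **Rank 2 ⇒ rank 4.**  `SwallowForcesShortRelation → PolySwallowForcesShortRelation`: a polynomial
swallowing exhibits the image of the monomial curve inside the image of `Γ` pointwise, so the curve is not
`(s,2)`-elusive. [folklore] -/
theorem polySwallow_of_swallow : SwallowForcesShortRelation → PolySwallowForcesShortRelation := by
  rintro ⟨m₀, h⟩
  refine ⟨m₀, fun m hm d s hs Γ y hΓ hy => h m hm d s hs ?_⟩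
  intro hel
  refine hel Γ hΓ ?_
  rintro _ ⟨a, rfl⟩
  refine ⟨fun j => (y j).eval (a 0), ?_⟩
  funext i
  simp only [polyMapEval_apply]
  have h1 : MvPolynomial.eval (fun j => (y j).eval (a 0)) (Γ i) =
      (MvPolynomial.aeval y (Γ i)).eval (a 0) := by
    rw [← Polynomial.coe_aeval_eq_eval, ← MvPolynomial.coe_aeval_eq_eval,
      MvPolynomial.comp_aeval_apply]
    rfl
  rw [h1, hy i]
  simp

end PolySwallowGlue

end Summit.ValiantsHypothesis.ValiantsHypothesis.Theorems
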